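import Literature.MathematicalPhysics.QuantumManyBody.GroundStateFeynmanKacFreeForm
import HarnessLib

/-!
# Ground-state Feynman–Kac: the killing (exit) term is `O(t^{3/2})` on `C¹` Dirichlet functions

Topic `Literature/MathematicalPhysics/QuantumManyBody`; support file for the proof of the named
fact `Literature.MathematicalPhysics.QuantumManyBody.BoseGas.GroundStateFeynmanKac` (variational
identification of the top of the spectrum of the Feynman–Kac semigroup, Chung–Zhao (1995)
Thm 3.27 / Prop 3.29, by small-time analysis). The Dirichlet killing at the boundary of the box
`Λ_L^N` costs nothing at first order in `t` on functions vanishing off the box with a bounded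
gradient: for `ψ` with `ψ = 0` off `Λ_L^N` and `|ψ(Y) - ψ(Z)| ≤ G ‖Y - Z‖`,

  `∫ dX E[ 𝟙{exit before t} |ψ(X)| |ψ(X + √2 b_t)| ] ≤ 792 √2 · N² G² L^{3N-1} · t^{3/2}`

(`lintegral_exit_le`). Mechanism: an exit before `t` from `X` forces a coordinate excursion
`min(X_{ik}, L - X_{ik}) ≤ √2 sup_{s≤t}|b_s(ω i k)|` (`exists_min_le_of_not_survives`), the two
factors are then small — `|ψ(X)| ≤ G min(X_{ik}, L - X_{ik})` (the nearest face, `abs_le_mul_min`)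
and `|ψ(X + √2 b_t)| ≤ 2√2 G ∑ sup|b|` (the path was on the boundary) — and the starting points
that can exit lie in a boundary slab of volume `≤ 2 r L^{3N-1}` (`volume_slab_le`, from the exact
volume of coordinate product sets `volume_setOf_forall_mem`); the third moments
`E[(sup_{s≤t}|b_s|)³] ≤ 11 t^{3/2}` come from Doob's `L²` inequality for the martingale
`b_t² - t` (`lintegral_runSup_pow_four_le`: `E[sup⁴] ≤ 18 t²`) and `E[sup²] ≤ 4t`.

## References

* K. L. Chung, Z. Zhao, *From Brownian Motion to Schrödinger's Equation* (1995), §2.4, Thm 3.27,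
  Prop 3.29. [ChungZhao1995]
* D. Revuz, M. Yor, *Continuous Martingales and Brownian Motion* (1999), Ch. II Thm (1.7).
  [RevuzYor1999]
-/

noncomputable section

namespace Literature.MathematicalPhysics.QuantumManyBody.BoseGas

open MeasureTheory ProbabilityTheory Filter Set
open scoped ENNReal NNReal Topology
open Literature.Probability.Process

variable {N : ℕ}

/-! ### Fourth and third moments of the running supremum -/

/-- `ofReal (runSup⁴) ≤ ⨆_{s ≤ t} ofReal (b_s⁴)` on every (continuous) path. [folklore] -/
theorem ofReal_runSup_pow_four_le (t : ℝ≥0) (η : ℝ≥0 → ℝ) :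
    ENNReal.ofReal (runSup t η ^ 4) ≤ ⨆ s ∈ Set.Iic t, ENNReal.ofReal (brownian s η ^ 4) := by
  have hbdd := bddAbove_range_abs_brownian_dyad t η
  set F : ℝ → ℝ≥0∞ := fun x => ENNReal.ofReal (max x 0 ^ 4) with hF
  have hFmono : Monotone F := fun x y hxy => by
    simp only [hF]
    exact ENNReal.ofReal_le_ofReal (pow_le_pow_left₀ (le_max_right _ _) (max_le_max hxy le_rfl) 4)
  have hFcont : Continuous F :=
    ENNReal.continuous_ofReal.comp ((continuous_id.max continuous_const).pow 4)
  have h1 := Monotone.map_ciSup_of_continuousAt (f := F) hFcont.continuousAt hFmono hbdd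
  have hFrun : F (runSup t η) = ENNReal.ofReal (runSup t η ^ 4) := by
    simp only [hF, max_eq_left (runSup_nonneg t η)]
  rw [← hFrun, runSup, h1]
  refine iSup_le fun p => ?_
  have hrw : F |brownian (dyadTime t p.1 p.2) η| =
      ENNReal.ofReal (brownian (dyadTime t p.1 p.2) η ^ 4) := by
    simp only [hF]
    rw [max_eq_left (abs_nonneg (brownian (dyadTime t p.1 p.2) η))]
    congr 1
    have : (4 : ℕ) = 2 * 2 := rfl
    rw [this, pow_mul, pow_mul, sq_abs]
  rw [hrw]
  exact le_iSup₂_of_le (f := fun s (_ : s ∈ Set.Iic t) => ENNReal.ofReal (brownian s η ^ 4))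
    (dyadTime t p.1 p.2) (show dyadTime t p.1 p.2 ∈ Set.Iic t from dyadTime_le t p.1 p.2) le_rfl

/-- **`E[(runSup t)⁴] ≤ 18 t²`**: Doob's `L²` inequality for the martingale `b_s² - s` gives
`E[sup_{s≤t}(b_s² - s)²] ≤ 4 E[(b_t² - t)²] = 8t²`, and `b_s⁴ ≤ 2(b_s² - s)² + 2t²`.
[cite: RevuzYor1999, Ch. II Thm (1.7)] -/
theorem lintegral_runSup_pow_four_le (t : ℝ≥0) :
    ∫⁻ η, ENNReal.ofReal (runSup t η ^ 4) ∂preWienerMeasure ≤ ENNReal.ofReal (18 * (t : ℝ) ^ 2) := by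
  haveI := Literature.Probability.RandomPlanarGeometry.isProbabilityMeasure_preWienerMeasure'
  set M : ℝ≥0 → (ℝ≥0 → ℝ) → ℝ := fun s η => brownian s η ^ 2 - (s : ℝ) with hM
  have hmart : Martingale M Literature.Probability.RandomPlanarGeometry.brownianFiltration
      preWienerMeasure :=
    Literature.Probability.RandomPlanarGeometry.martingale_brownian_sq_sub_holds
  have hL2 : ∀ s, MemLp (M s) 2 preWienerMeasure := fun s => by
    have h1 := memLp_two_brownian_sub_sq 0 s
    simp only [brownian_zero, sub_zero] at h1
    exact h1.sub (memLp_const _)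
  have hcont : ∀ᵐ η ∂preWienerMeasure, Continuous (M · η) :=
    Eventually.of_forall fun η => ((continuous_brownian η).pow 2).sub NNReal.continuous_coe
  have hD := doob_lintegral_iSup_sq_le_of_continuous hmart hL2 hcont t
  -- pointwise comparison of the suprema
  have hpt : ∀ η, (⨆ s ∈ Set.Iic t, ENNReal.ofReal (brownian s η ^ 4)) ≤
      ENNReal.ofReal 2 * (⨆ s ∈ Set.Iic t, ENNReal.ofReal (M s η ^ 2)) +
        ENNReal.ofReal 2 * ENNReal.ofReal ((t : ℝ) ^ 2) := by
    intro η
    refine iSup₂_le fun s hs => ?_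
    have hs' : (s : ℝ) ≤ t := hs
    have hb : brownian s η ^ 4 ≤ 2 * M s η ^ 2 + 2 * (t : ℝ) ^ 2 := by
      have hsq : brownian s η ^ 2 = M s η + s := by simp [hM]
      have hs2 : (s : ℝ) ^ 2 ≤ (t : ℝ) ^ 2 := pow_le_pow_left₀ s.coe_nonneg hs' 2
      calc brownian s η ^ 4 = (brownian s η ^ 2) ^ 2 := by ring
        _ = (M s η + s) ^ 2 := by rw [hsq]
        _ ≤ 2 * M s η ^ 2 + 2 * (s : ℝ) ^ 2 := by nlinarith [sq_nonneg (M s η - s)]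
        _ ≤ 2 * M s η ^ 2 + 2 * (t : ℝ) ^ 2 := by linarith
    calc ENNReal.ofReal (brownian s η ^ 4)
        ≤ ENNReal.ofReal (2 * M s η ^ 2 + 2 * (t : ℝ) ^ 2) := ENNReal.ofReal_le_ofReal hb
      _ = ENNReal.ofReal 2 * ENNReal.ofReal (M s η ^ 2) +
            ENNReal.ofReal 2 * ENNReal.ofReal ((t : ℝ) ^ 2) := by
          rw [ENNReal.ofReal_add (by positivity) (by positivity), ENNReal.ofReal_mul zero_le_two,
            ENNReal.ofReal_mul zero_le_two]
      _ ≤ ENNReal.ofReal 2 * (⨆ s ∈ Set.Iic t, ENNReal.ofReal (M s η ^ 2)) +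
            ENNReal.ofReal 2 * ENNReal.ofReal ((t : ℝ) ^ 2) := by
          gcongr
          exact le_iSup₂_of_le (f := fun s (_ : s ∈ Set.Iic t) => ENNReal.ofReal (M s η ^ 2)) s hs
            le_rfl
  have hM2 : ∫⁻ η, ENNReal.ofReal (M t η ^ 2) ∂preWienerMeasure = ENNReal.ofReal (2 * (t : ℝ) ^ 2) := by
    have hint : Integrable (fun η => M t η ^ 2) preWienerMeasure := (hL2 t).integrable_sq
    rw [← ofReal_integral_eq_lintegral_ofReal hint (Eventually.of_forall fun η => sq_nonneg _)]
    simp only [hM]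
    rw [integral_brownian_sq_sub_sq]
  calc ∫⁻ η, ENNReal.ofReal (runSup t η ^ 4) ∂preWienerMeasure
      ≤ ∫⁻ η, ⨆ s ∈ Set.Iic t, ENNReal.ofReal (brownian s η ^ 4) ∂preWienerMeasure :=
        lintegral_mono fun η => ofReal_runSup_pow_four_le t η
    _ ≤ ∫⁻ η, (ENNReal.ofReal 2 * (⨆ s ∈ Set.Iic t, ENNReal.ofReal (M s η ^ 2)) +
        ENNReal.ofReal 2 * ENNReal.ofReal ((t : ℝ) ^ 2)) ∂preWienerMeasure := lintegral_mono hpt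
    _ = ENNReal.ofReal 2 * ∫⁻ η, (⨆ s ∈ Set.Iic t, ENNReal.ofReal (M s η ^ 2)) ∂preWienerMeasure +
        ENNReal.ofReal 2 * ENNReal.ofReal ((t : ℝ) ^ 2) := by
        rw [lintegral_add_right _ measurable_const, lintegral_const_mul' _ _ ENNReal.ofReal_ne_top,
          lintegral_const, measure_univ, mul_one]
    _ ≤ ENNReal.ofReal 2 * (ENNReal.ofReal 4 * ENNReal.ofReal (2 * (t : ℝ) ^ 2)) +
        ENNReal.ofReal 2 * ENNReal.ofReal ((t : ℝ) ^ 2) := by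
        rw [← hM2, ENNReal.ofReal_ofNat 4]
        gcongr
    _ = ENNReal.ofReal (18 * (t : ℝ) ^ 2) := by
        rw [← ENNReal.ofReal_mul (by norm_num : (0 : ℝ) ≤ 4),
          ← ENNReal.ofReal_mul (by norm_num : (0 : ℝ) ≤ 2),
          ← ENNReal.ofReal_mul (by norm_num : (0 : ℝ) ≤ 2),
          ← ENNReal.ofReal_add (by positivity) (by positivity)]
        congr 1
        ring

/-- `∫⁻ ofReal (runSup²) ≤ ofReal (4t)` (the tree's `E[runSup²] ≤ 4t` in lower-integral form).
[folklore] -/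
theorem lintegral_runSup_sq_le (t : ℝ≥0) :
    ∫⁻ η, ENNReal.ofReal (runSup t η ^ 2) ∂preWienerMeasure ≤ ENNReal.ofReal (4 * (t : ℝ)) := by
  rw [← ofReal_integral_eq_lintegral_ofReal (integrable_runSup_sq t)
    (Eventually.of_forall fun η => sq_nonneg _)]
  exact ENNReal.ofReal_le_ofReal (integral_runSup_sq_le t)

/-- Elementary: `2 r³ ≤ c⁻¹ r⁴ + c r²` for `c > 0`, `r ≥ 0` (here `c = √t`). [folklore] -/
theorem two_mul_pow_three_le (r : ℝ) {c : ℝ} (hc : 0 < c) :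
    2 * r ^ 3 ≤ c⁻¹ * r ^ 4 + c * r ^ 2 := by
  have h : 0 ≤ c⁻¹ * (r ^ 2 - c * r) ^ 2 := by positivity
  have hexp : c⁻¹ * (r ^ 2 - c * r) ^ 2 = c⁻¹ * r ^ 4 - 2 * r ^ 3 + c * r ^ 2 := by
    field_simp
    ring
  linarith [hexp ▸ h]

/-- **`E[(runSup t)³] ≤ 11 t^{3/2}`** (`2r³ ≤ t^{-1/2} r⁴ + t^{1/2} r²` and the fourth/second
moment bounds). [cite: RevuzYor1999, Ch. II Thm (1.7)] -/
theorem lintegral_runSup_pow_three_le {t : ℝ≥0} (ht : t ≠ 0) :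
    ∫⁻ η, ENNReal.ofReal (runSup t η ^ 3) ∂preWienerMeasure ≤
      ENNReal.ofReal (11 * ((t : ℝ) * Real.sqrt t)) := by
  have ht' : (0 : ℝ) < t := lt_of_le_of_ne t.coe_nonneg (fun h => ht (by exact_mod_cast h.symm))
  set c := Real.sqrt (t : ℝ) with hc
  have hcpos : 0 < c := Real.sqrt_pos.2 ht'
  have hcsq : c * c = t := Real.mul_self_sqrt ht'.le
  have hm4 : Measurable fun η : ℝ≥0 → ℝ => ENNReal.ofReal (runSup t η ^ 4) :=
    ENNReal.measurable_ofReal.comp ((measurable_runSup t).pow_const 4)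
  have hm2 : Measurable fun η : ℝ≥0 → ℝ => ENNReal.ofReal (runSup t η ^ 2) :=
    ENNReal.measurable_ofReal.comp ((measurable_runSup t).pow_const 2)
  -- pointwise
  have hpt : ∀ η, ENNReal.ofReal (runSup t η ^ 3) ≤
      ENNReal.ofReal (c⁻¹ / 2) * ENNReal.ofReal (runSup t η ^ 4) +
        ENNReal.ofReal (c / 2) * ENNReal.ofReal (runSup t η ^ 2) := by
    intro η
    have h := two_mul_pow_three_le (runSup t η) hcpos
    calc ENNReal.ofReal (runSup t η ^ 3)
        ≤ ENNReal.ofReal (c⁻¹ / 2 * runSup t η ^ 4 + c / 2 * runSup t η ^ 2) :=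
          ENNReal.ofReal_le_ofReal (by linarith)
      _ = _ := by
          rw [ENNReal.ofReal_add (by positivity) (by positivity), ENNReal.ofReal_mul (by positivity),
            ENNReal.ofReal_mul (by positivity)]
  calc ∫⁻ η, ENNReal.ofReal (runSup t η ^ 3) ∂preWienerMeasure
      ≤ ∫⁻ η, (ENNReal.ofReal (c⁻¹ / 2) * ENNReal.ofReal (runSup t η ^ 4) +
          ENNReal.ofReal (c / 2) * ENNReal.ofReal (runSup t η ^ 2)) ∂preWienerMeasure :=
        lintegral_mono hpt
    _ = ENNReal.ofReal (c⁻¹ / 2) * ∫⁻ η, ENNReal.ofReal (runSup t η ^ 4) ∂preWienerMeasure +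
        ENNReal.ofReal (c / 2) * ∫⁻ η, ENNReal.ofReal (runSup t η ^ 2) ∂preWienerMeasure := by
        rw [lintegral_add_left (hm4.const_mul _), lintegral_const_mul _ hm4, lintegral_const_mul _ hm2]
    _ ≤ ENNReal.ofReal (c⁻¹ / 2) * ENNReal.ofReal (18 * (t : ℝ) ^ 2) +
        ENNReal.ofReal (c / 2) * ENNReal.ofReal (4 * (t : ℝ)) := by
        gcongr
        · exact lintegral_runSup_pow_four_le t
        · exact lintegral_runSup_sq_le t
    _ = ENNReal.ofReal (11 * ((t : ℝ) * Real.sqrt t)) := by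
        rw [← ENNReal.ofReal_mul (by positivity : (0 : ℝ) ≤ c⁻¹ / 2),
          ← ENNReal.ofReal_mul (by positivity : (0 : ℝ) ≤ c / 2),
          ← ENNReal.ofReal_add (by positivity) (by positivity)]
        congr 1
        rw [← hc]
        have ht2 : (t : ℝ) = c * c := hcsq.symm
        rw [ht2]
        field_simp
        ring

/-! ### Moments of the coordinate running suprema on `PathSpace N` -/

/-- Double constant sums over the `3N` coordinates. [folklore] -/
theorem sum_sum_const (C : ℝ≥0∞) : ∑ _i : Fin N, ∑ _k : Fin 3, C = ENNReal.ofReal (3 * N) * C := by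
  simp only [Finset.sum_const, Finset.card_univ, Fintype.card_fin, nsmul_eq_mul]
  rw [ENNReal.ofReal_mul (by norm_num : (0 : ℝ) ≤ 3), ENNReal.ofReal_natCast, ENNReal.ofReal_ofNat]
  push_cast
  ring

/-- Third moment of a coordinate running supremum: `E[(runSup t (ω i k))³] ≤ 11 t^{3/2}`.
[folklore] -/
theorem lintegral_runSup_coord_pow_three_le {t : ℝ≥0} (ht : t ≠ 0) (i : Fin N) (k : Fin 3) :
    ∫⁻ ω, ENNReal.ofReal (runSup t (ω i k) ^ 3) ∂wienerPaths N ≤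
      ENNReal.ofReal (11 * ((t : ℝ) * Real.sqrt t)) := by
  have h : ∫⁻ ω, ENNReal.ofReal (runSup t (ω i k) ^ 3) ∂wienerPaths N =
      ∫⁻ η, ENNReal.ofReal (runSup t η ^ 3) ∂preWienerMeasure :=
    (measurePreserving_apply₂ (N := N) i k).lintegral_comp (f := fun η => ENNReal.ofReal (runSup t η ^ 3))
      (ENNReal.measurable_ofReal.comp ((measurable_runSup t).pow_const 3))
  rw [h]
  exact lintegral_runSup_pow_three_le ht

/-- Young's inequality in the form `a b² ≤ (a³ + 2 b³)/3` for `a, b ≥ 0`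
(`a³ + 2b³ - 3ab² = (a - b)²(a + 2b)`). [folklore] -/
theorem mul_sq_le_pow_three {a b : ℝ} (ha : 0 ≤ a) (hb : 0 ≤ b) :
    a * b ^ 2 ≤ (a ^ 3 + 2 * b ^ 3) / 3 := by
  have h : 0 ≤ (a - b) ^ 2 * (a + 2 * b) := by positivity
  nlinarith [h]

/-- **Mixed cubic moments**: `E[runSup(ω j l) · runSup(ω i k)²] ≤ 11 t^{3/2}`. [folklore] -/
theorem lintegral_runSup_mul_sq_le {t : ℝ≥0} (ht : t ≠ 0) (i j : Fin N) (k l : Fin 3) :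
    ∫⁻ ω, ENNReal.ofReal (runSup t (ω j l) * runSup t (ω i k) ^ 2) ∂wienerPaths N ≤
      ENNReal.ofReal (11 * ((t : ℝ) * Real.sqrt t)) := by
  have hm : ∀ (i : Fin N) (k : Fin 3), Measurable fun ω : PathSpace N =>
      ENNReal.ofReal (runSup t (ω i k) ^ 3) := fun i k =>
    ENNReal.measurable_ofReal.comp (((measurable_runSup t).comp
      ((measurable_pi_apply k).comp (measurable_pi_apply i))).pow_const 3)
  calc ∫⁻ ω, ENNReal.ofReal (runSup t (ω j l) * runSup t (ω i k) ^ 2) ∂wienerPaths N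
      ≤ ∫⁻ ω, (ENNReal.ofReal (1 / 3) * ENNReal.ofReal (runSup t (ω j l) ^ 3) +
          ENNReal.ofReal (2 / 3) * ENNReal.ofReal (runSup t (ω i k) ^ 3)) ∂wienerPaths N := by
        refine lintegral_mono fun ω => ?_
        have := mul_sq_le_pow_three (runSup_nonneg t (ω j l)) (runSup_nonneg t (ω i k))
        calc ENNReal.ofReal (runSup t (ω j l) * runSup t (ω i k) ^ 2)
            ≤ ENNReal.ofReal (1 / 3 * runSup t (ω j l) ^ 3 + 2 / 3 * runSup t (ω i k) ^ 3) :=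
              ENNReal.ofReal_le_ofReal (by linarith)
          _ = _ := by
              rw [ENNReal.ofReal_add (mul_nonneg (by norm_num) (pow_nonneg (runSup_nonneg _ _) 3))
                (mul_nonneg (by norm_num) (pow_nonneg (runSup_nonneg _ _) 3)),
                ENNReal.ofReal_mul (by norm_num), ENNReal.ofReal_mul (by norm_num)]
    _ = ENNReal.ofReal (1 / 3) * ∫⁻ ω, ENNReal.ofReal (runSup t (ω j l) ^ 3) ∂wienerPaths N +
        ENNReal.ofReal (2 / 3) * ∫⁻ ω, ENNReal.ofReal (runSup t (ω i k) ^ 3) ∂wienerPaths N := by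
        rw [lintegral_add_left ((hm j l).const_mul _), lintegral_const_mul _ (hm j l),
          lintegral_const_mul _ (hm i k)]
    _ ≤ ENNReal.ofReal (1 / 3) * ENNReal.ofReal (11 * ((t : ℝ) * Real.sqrt t)) +
        ENNReal.ofReal (2 / 3) * ENNReal.ofReal (11 * ((t : ℝ) * Real.sqrt t)) := by
        gcongr
        · exact lintegral_runSup_coord_pow_three_le ht j l
        · exact lintegral_runSup_coord_pow_three_le ht i k
    _ = ENNReal.ofReal (11 * ((t : ℝ) * Real.sqrt t)) := by
        rw [← ENNReal.ofReal_mul (by norm_num : (0 : ℝ) ≤ 1 / 3),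
          ← ENNReal.ofReal_mul (by norm_num : (0 : ℝ) ≤ 2 / 3),
          ← ENNReal.ofReal_add (by positivity) (by positivity)]
        congr 1
        ring

/-- **The cubic functional of the exit bound**:
`E[(∑_{j,l} runSup(ω j l)) · runSup(ω i k)²] ≤ 3N · 11 t^{3/2}`. [folklore] -/
theorem lintegral_sum_runSup_mul_sq_le {t : ℝ≥0} (ht : t ≠ 0) (i : Fin N) (k : Fin 3) :
    ∫⁻ ω, ENNReal.ofReal ((∑ j, ∑ l, runSup t (ω j l)) * runSup t (ω i k) ^ 2) ∂wienerPaths N ≤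
      ENNReal.ofReal ((3 * N : ℕ) * (11 * ((t : ℝ) * Real.sqrt t))) := by
  have hm : ∀ (j : Fin N) (l : Fin 3), Measurable fun ω : PathSpace N =>
      ENNReal.ofReal (runSup t (ω j l) * runSup t (ω i k) ^ 2) := fun j l =>
    ENNReal.measurable_ofReal.comp ((((measurable_runSup t).comp
      ((measurable_pi_apply l).comp (measurable_pi_apply j)))).mul
      (((measurable_runSup t).comp ((measurable_pi_apply k).comp (measurable_pi_apply i))).pow_const 2))
  have hexp : ∀ ω : PathSpace N, ENNReal.ofReal ((∑ j, ∑ l, runSup t (ω j l)) * runSup t (ω i k) ^ 2)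
      = ∑ j, ∑ l, ENNReal.ofReal (runSup t (ω j l) * runSup t (ω i k) ^ 2) := by
    intro ω
    rw [Finset.sum_mul, ENNReal.ofReal_sum_of_nonneg (fun j _ =>
      mul_nonneg (Finset.sum_nonneg fun l _ => runSup_nonneg t (ω j l)) (sq_nonneg _))]
    refine Finset.sum_congr rfl fun j _ => ?_
    rw [Finset.sum_mul, ENNReal.ofReal_sum_of_nonneg (fun l _ =>
      mul_nonneg (runSup_nonneg t (ω j l)) (sq_nonneg _))]
  simp_rw [hexp]
  rw [lintegral_finsetSum _ fun j _ => Finset.measurable_sum _ fun l _ => hm j l]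
  simp_rw [lintegral_finsetSum _ fun l _ => hm _ l]
  calc ∑ j : Fin N, ∑ l : Fin 3, ∫⁻ ω, ENNReal.ofReal (runSup t (ω j l) * runSup t (ω i k) ^ 2)
        ∂wienerPaths N
      ≤ ∑ _j : Fin N, ∑ _l : Fin 3, ENNReal.ofReal (11 * ((t : ℝ) * Real.sqrt t)) :=
        Finset.sum_le_sum fun j _ => Finset.sum_le_sum fun l _ => lintegral_runSup_mul_sq_le ht i j k l
    _ = ENNReal.ofReal (3 * N) * ENNReal.ofReal (11 * ((t : ℝ) * Real.sqrt t)) := sum_sum_const _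
    _ = ENNReal.ofReal ((3 * N : ℕ) * (11 * ((t : ℝ) * Real.sqrt t))) := by
        rw [← ENNReal.ofReal_mul (by positivity : (0 : ℝ) ≤ 3 * N)]
        push_cast
        rfl

/-! ### Volumes of coordinate product sets and boundary slabs -/

/-- **Volume of a coordinate product set** in `(ℝ³)^N`:
`|{X | ∀ i k, X i k ∈ s i k}| = ∏ᵢ ∏ₖ |s i k|`. [folklore] -/
theorem volume_setOf_forall_mem (s : Fin N → Fin 3 → Set ℝ) (hs : ∀ i k, MeasurableSet (s i k)) :
    volume {X : Config N | ∀ i k, X i k ∈ s i k} = ∏ i, ∏ k, volume (s i k) := by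
  have hset : {X : Config N | ∀ i k, X i k ∈ s i k} =
      Set.univ.pi fun i : Fin N => (WithLp.ofLp : Space → Fin 3 → ℝ) ⁻¹' Set.univ.pi (s i) := by
    ext X
    simp only [Set.mem_setOf_eq, Set.mem_univ_pi, Set.mem_preimage]
  rw [hset, volume_pi_pi]
  refine Finset.prod_congr rfl fun i _ => ?_
  rw [(PiLp.volume_preserving_ofLp (Fin 3)).measure_preimage
    (MeasurableSet.univ_pi (hs i)).nullMeasurableSet, volume_pi_pi]

/-- **Volume of a boundary slab of the box**: for `r ≥ 0` and `L ≥ 0`,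
`|{X ∈ Λ_L^N | min(X_{ik}, L - X_{ik}) ≤ r}| ≤ 2 r L^{3N-1}`. [folklore] -/
theorem volume_slab_le {L r : ℝ} (hL : 0 ≤ L) (hr : 0 ≤ r) (i : Fin N) (k : Fin 3) :
    volume {X : Config N | X ∈ boxN N L ∧ min (X i k) (L - X i k) ≤ r} ≤
      ENNReal.ofReal (2 * r * L ^ (3 * N - 1)) := by
  classical
  -- the two one-sided slabs, as coordinate product sets
  set sLow : Fin N → Fin 3 → Set ℝ := fun j l =>
    if j = i ∧ l = k then Set.Ioc 0 r else Set.Ioo 0 L with hsLow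
  set sUp : Fin N → Fin 3 → Set ℝ := fun j l =>
    if j = i ∧ l = k then Set.Ico (L - r) L else Set.Ioo 0 L with hsUp
  have hmeasL : ∀ j l, MeasurableSet (sLow j l) := fun j l => by
    simp only [hsLow]; split_ifs <;> measurability
  have hmeasU : ∀ j l, MeasurableSet (sUp j l) := fun j l => by
    simp only [hsUp]; split_ifs <;> measurability
  have hsub : {X : Config N | X ∈ boxN N L ∧ min (X i k) (L - X i k) ≤ r} ⊆
      {X : Config N | ∀ j l, X j l ∈ sLow j l} ∪ {X : Config N | ∀ j l, X j l ∈ sUp j l} := by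
    intro X hX
    obtain ⟨hbox, hmin⟩ := hX
    have hco : ∀ j l, X j l ∈ Set.Ioo 0 L := fun j l => (hbox j) l
    rcases min_le_iff.1 hmin with h | h
    · left
      intro j l
      simp only [hsLow]
      split_ifs with hjl
      · obtain ⟨rfl, rfl⟩ := hjl
        exact ⟨(hco j l).1, h⟩
      · exact hco j l
    · right
      intro j l
      simp only [hsUp]
      split_ifs with hjl
      · obtain ⟨rfl, rfl⟩ := hjl
        exact ⟨by linarith, (hco j l).2⟩
      · exact hco j l
  -- volume of a product set with one exceptional factor of length `≤ r`
  have hprod : ∀ (s : Fin N → Fin 3 → Set ℝ), (∀ j l, MeasurableSet (s j l)) →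
      (∀ j l, ¬(j = i ∧ l = k) → s j l = Set.Ioo 0 L) → volume (s i k) ≤ ENNReal.ofReal r →
      volume {X : Config N | ∀ j l, X j l ∈ s j l} ≤ ENNReal.ofReal (r * L ^ (3 * N - 1)) := by
    intro s hs hother hik
    rw [volume_setOf_forall_mem s hs, ← Fintype.prod_prod_type' (f := fun j l => volume (s j l)),
      ← Finset.mul_prod_erase Finset.univ (fun p : Fin N × Fin 3 => volume (s p.1 p.2))
        (Finset.mem_univ (i, k))]
    have hrest : ∏ p ∈ Finset.univ.erase (i, k), volume (s p.1 p.2) = ENNReal.ofReal L ^ (3 * N - 1) := by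
      rw [Finset.prod_congr rfl (fun p hp => by
        rw [hother p.1 p.2 (fun h => (Finset.ne_of_mem_erase hp) (Prod.ext h.1 h.2)),
          Real.volume_Ioo, sub_zero]), Finset.prod_const, Finset.card_erase_of_mem (Finset.mem_univ _)]
      simp [Finset.card_univ, mul_comm]
    rw [hrest, ENNReal.ofReal_mul hr, ENNReal.ofReal_pow hL]
    exact mul_le_mul' hik le_rfl
  have hLow : volume {X : Config N | ∀ j l, X j l ∈ sLow j l} ≤ ENNReal.ofReal (r * L ^ (3 * N - 1)) := by
    refine hprod sLow hmeasL (fun j l hjl => by simp only [hsLow, if_neg hjl]) ?_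
    simp only [hsLow, and_self, if_true, Real.volume_Ioc, sub_zero, le_refl]
  have hUp : volume {X : Config N | ∀ j l, X j l ∈ sUp j l} ≤ ENNReal.ofReal (r * L ^ (3 * N - 1)) := by
    refine hprod sUp hmeasU (fun j l hjl => by simp only [hsUp, if_neg hjl]) ?_
    simp only [hsUp, and_self, if_true, Real.volume_Ico]
    exact ENNReal.ofReal_le_ofReal (by linarith)
  calc volume {X : Config N | X ∈ boxN N L ∧ min (X i k) (L - X i k) ≤ r}
      ≤ volume ({X : Config N | ∀ j l, X j l ∈ sLow j l} ∪ {X : Config N | ∀ j l, X j l ∈ sUp j l}) :=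
        measure_mono hsub
    _ ≤ volume {X : Config N | ∀ j l, X j l ∈ sLow j l} + volume {X : Config N | ∀ j l, X j l ∈ sUp j l} :=
        measure_union_le _ _
    _ ≤ ENNReal.ofReal (r * L ^ (3 * N - 1)) + ENNReal.ofReal (r * L ^ (3 * N - 1)) :=
        add_le_add hLow hUp
    _ = ENNReal.ofReal (2 * r * L ^ (3 * N - 1)) := by
        rw [← ENNReal.ofReal_add (by positivity) (by positivity)]
        congr 1; ring

/-! ### Face points and the exit lemma -/

/-- The coordinate vector `e_{ik}` has norm one. [folklore] -/
theorem norm_single_single (i : Fin N) (k : Fin 3) :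
    ‖(Pi.single i (EuclideanSpace.single k (1 : ℝ)) : Config N)‖ = 1 := by
  rw [Pi.norm_single, EuclideanSpace.single, PiLp.norm_single, norm_one]

/-- Moving the coordinate `(i, k)`: `(X + a • e_{ik}) i k = X i k + a`, other coordinates unchanged.
[folklore] -/
theorem add_smul_single_apply (X : Config N) (a : ℝ) (i j : Fin N) (k l : Fin 3) :
    (X + a • (Pi.single i (EuclideanSpace.single k (1 : ℝ)) : Config N)) j l =
      X j l + if j = i ∧ l = k then a else 0 := by
  simp only [Pi.add_apply, Pi.smul_apply, WithLp.ofLp_add, WithLp.ofLp_smul, Pi.single_apply]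
  by_cases hj : j = i
  · subst hj
    simp only [if_true, PiLp.single_apply]  -- coordinates of the Euclidean single
    by_cases hl : l = k
    · subst hl; simp
    · simp [hl]
  · simp [hj]

/-- **The nearest face**: a function vanishing off the open box with Lipschitz constant `G` is
bounded at `X ∈ Λ_L^N` by `G · min(X_{ik}, L - X_{ik})` for every coordinate `(i, k)`. [folklore] -/
theorem abs_le_mul_min {ψ : Config N → ℝ} {L G : ℝ} (h0 : ∀ Y, Y ∉ boxN N L → ψ Y = 0)
    (hLip : ∀ Y Z, |ψ Y - ψ Z| ≤ G * ‖Y - Z‖) {X : Config N} (hX : X ∈ boxN N L)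
    (i : Fin N) (k : Fin 3) :
    |ψ X| ≤ G * min (X i k) (L - X i k) := by
  set e : Config N := Pi.single i (EuclideanSpace.single k (1 : ℝ)) with he
  have hXik : X i k ∈ Set.Ioo 0 L := (hX i) k
  -- the two face points
  have hface : ∀ a : ℝ, (X + a • e) i k ∉ Set.Ioo 0 L → |ψ X| ≤ G * |a| := by
    intro a ha
    have hnot : X + a • e ∉ boxN N L := fun hb => ha ((hb i) k)
    have h1 := hLip X (X + a • e)
    rw [h0 _ hnot, sub_zero, sub_add_cancel_left, norm_neg, norm_smul, he, norm_single_single,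
      mul_one, Real.norm_eq_abs] at h1
    exact h1
  rcases le_total (X i k) (L - X i k) with hle | hle
  · rw [min_eq_left hle]
    have h := hface (-(X i k)) (by
      rw [add_smul_single_apply]; simp)
    rwa [abs_neg, abs_of_pos hXik.1] at h
  · rw [min_eq_right hle]
    have h := hface (L - X i k) (by
      rw [add_smul_single_apply]; simp)
    rwa [abs_of_nonneg (sub_nonneg.2 hXik.2.le)] at h

/-- **Exit lemma**: if the world-lines started at `X ∈ Λ_L^N` do not survive up to time `t`, some
coordinate made an excursion of size at least the distance to the corresponding pair of faces:
`min(X_{ik}, L - X_{ik}) ≤ √2 · runSup t (ω i k)`; moreover at the exit time `s` the world-line is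
outside the box. [folklore] -/
theorem exists_min_le_of_not_survives {L : ℝ} {t : ℝ≥0} {X : Config N} (hX : X ∈ boxN N L)
    {ω : PathSpace N} (hω : ω ∉ survives L t X) :
    ∃ s : ℝ≥0, s ≤ t ∧ X + displacement s ω ∉ boxN N L ∧
      ∃ i k, min (X i k) (L - X i k) ≤ Real.sqrt 2 * runSup t (ω i k) := by
  simp only [survives, Set.mem_setOf_eq, not_forall, exists_prop] at hω
  obtain ⟨r, hr, hnot⟩ := hω
  have hrt : r.toNNReal ≤ t := Real.toNNReal_le_iff_le_coe.2 hr.2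
  refine ⟨r.toNNReal, hrt, hnot, ?_⟩
  -- some coordinate is outside `(0, L)`
  have : ∃ i k, (X + displacement r.toNNReal ω) i k ∉ Set.Ioo 0 L := by
    by_contra hcon
    simp only [not_exists, not_not] at hcon
    exact hnot fun i k => hcon i k
  obtain ⟨i, k, hik⟩ := this
  refine ⟨i, k, ?_⟩
  have hb : |brownian r.toNNReal (ω i k)| ≤ runSup t (ω i k) := abs_brownian_le_runSup hrt _
  have hcoord : (X + displacement r.toNNReal ω) i k = X i k + Real.sqrt 2 * brownian r.toNNReal (ω i k) := by
    simp [displacement]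
  rw [hcoord, Set.mem_Ioo, not_and_or, not_lt, not_lt] at hik
  have hXik : X i k ∈ Set.Ioo 0 L := (hX i) k
  have h2 : |Real.sqrt 2 * brownian r.toNNReal (ω i k)| ≤ Real.sqrt 2 * runSup t (ω i k) := by
    rw [abs_mul, abs_of_nonneg (Real.sqrt_nonneg _)]
    exact mul_le_mul_of_nonneg_left hb (Real.sqrt_nonneg _)
  rcases hik with h | h
  · calc min (X i k) (L - X i k) ≤ X i k := min_le_left _ _
      _ ≤ |Real.sqrt 2 * brownian r.toNNReal (ω i k)| := by
          rw [le_abs]; right; linarith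
      _ ≤ _ := h2
  · calc min (X i k) (L - X i k) ≤ L - X i k := min_le_right _ _
      _ ≤ |Real.sqrt 2 * brownian r.toNNReal (ω i k)| := by
          rw [le_abs]; left; linarith
      _ ≤ _ := h2

/-- **After an exit the second factor is small**: if the world-line was outside the box at some
`s ≤ t`, then `|ψ(X + √2 b_t)| ≤ G · 2√2 ∑ runSup t (ω j l)` for `ψ` vanishing off the box with
Lipschitz constant `G`. [folklore] -/
theorem abs_comp_le_of_exit {ψ : Config N → ℝ} {L G : ℝ} (h0 : ∀ Y, Y ∉ boxN N L → ψ Y = 0)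
    (hLip : ∀ Y Z, |ψ Y - ψ Z| ≤ G * ‖Y - Z‖) (hG : 0 ≤ G) {t s : ℝ≥0} (hs : s ≤ t)
    (X : Config N) {ω : PathSpace N} (hout : X + displacement s ω ∉ boxN N L) :
    |ψ (X + displacement t ω)| ≤ G * (2 * (Real.sqrt 2 * ∑ j, ∑ l, runSup t (ω j l))) := by
  have h1 := hLip (X + displacement t ω) (X + displacement s ω)
  rw [h0 _ hout, sub_zero, add_sub_add_left_eq_sub] at h1
  refine h1.trans (mul_le_mul_of_nonneg_left ?_ hG)
  calc ‖displacement t ω - displacement s ω‖ ≤ ‖displacement t ω‖ + ‖displacement s ω‖ :=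
        norm_sub_le _ _
    _ ≤ Real.sqrt 2 * ∑ j, ∑ l, runSup t (ω j l) + Real.sqrt 2 * ∑ j, ∑ l, runSup t (ω j l) :=
        add_le_add (norm_displacement_le_sum_runSup le_rfl ω) (norm_displacement_le_sum_runSup hs ω)
    _ = 2 * (Real.sqrt 2 * ∑ j, ∑ l, runSup t (ω j l)) := by ring

/-! ### The exit term -/

/-- **Pointwise exit bound**: for `X ∈ Λ_L^N`,
`𝟙{exit ≤ t} |ψ(X)| |ψ(X + √2 b_t)| ≤ ∑_{i,k} 𝟙{min(X_{ik}, L-X_{ik}) ≤ √2 runSup(ω i k)} ·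
G min(X_{ik}, L-X_{ik}) · 2√2 G ∑ runSup`. [folklore] -/
theorem exit_integrand_le {ψ : Config N → ℝ} {L G : ℝ} (h0 : ∀ Y, Y ∉ boxN N L → ψ Y = 0)
    (hLip : ∀ Y Z, |ψ Y - ψ Z| ≤ G * ‖Y - Z‖) (hG : 0 ≤ G) (t : ℝ≥0) (X : Config N)
    (ω : PathSpace N) :
    (survives L t X)ᶜ.indicator (1 : PathSpace N → ℝ≥0∞) ω *
        (‖ψ X‖ₑ * ‖ψ (X + displacement t ω)‖ₑ) ≤
      ∑ i, ∑ k, {ω : PathSpace N | min (X i k) (L - X i k) ≤ Real.sqrt 2 * runSup t (ω i k)}.indicator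
        (fun ω => ENNReal.ofReal (G * min (X i k) (L - X i k)) *
          ENNReal.ofReal (G * (2 * (Real.sqrt 2 * ∑ j, ∑ l, runSup t (ω j l))))) ω := by
  by_cases hω : ω ∈ survives L t X
  · rw [Set.indicator_of_notMem (Set.notMem_compl_iff.2 hω)]
    simp
  by_cases hX : X ∈ boxN N L
  swap
  · rw [h0 X hX]; simp
  rw [Set.indicator_of_mem (Set.mem_compl hω), Pi.one_apply, one_mul]
  obtain ⟨s, hs, hout, i, k, hik⟩ := exists_min_le_of_not_survives hX hω
  have hterm : ‖ψ X‖ₑ * ‖ψ (X + displacement t ω)‖ₑ ≤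
      {ω : PathSpace N | min (X i k) (L - X i k) ≤ Real.sqrt 2 * runSup t (ω i k)}.indicator
        (fun ω => ENNReal.ofReal (G * min (X i k) (L - X i k)) *
          ENNReal.ofReal (G * (2 * (Real.sqrt 2 * ∑ j, ∑ l, runSup t (ω j l))))) ω := by
    rw [Set.indicator_of_mem (show ω ∈ {ω : PathSpace N |
      min (X i k) (L - X i k) ≤ Real.sqrt 2 * runSup t (ω i k)} from hik)]
    rw [Real.enorm_eq_ofReal_abs, Real.enorm_eq_ofReal_abs]
    exact mul_le_mul' (ENNReal.ofReal_le_ofReal (abs_le_mul_min h0 hLip hX i k))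
      (ENNReal.ofReal_le_ofReal (abs_comp_le_of_exit h0 hLip hG hs X hout))
  refine hterm.trans ?_
  refine (Finset.single_le_sum (f := fun k' => {ω : PathSpace N |
      min (X i k') (L - X i k') ≤ Real.sqrt 2 * runSup t (ω i k')}.indicator
        (fun ω => ENNReal.ofReal (G * min (X i k') (L - X i k')) *
          ENNReal.ofReal (G * (2 * (Real.sqrt 2 * ∑ j, ∑ l, runSup t (ω j l))))) ω)
      (fun _ _ => bot_le) (Finset.mem_univ k)).trans ?_
  exact Finset.single_le_sum (f := fun i' => ∑ k', {ω : PathSpace N |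
      min (X i' k') (L - X i' k') ≤ Real.sqrt 2 * runSup t (ω i' k')}.indicator
        (fun ω => ENNReal.ofReal (G * min (X i' k') (L - X i' k')) *
          ENNReal.ofReal (G * (2 * (Real.sqrt 2 * ∑ j, ∑ l, runSup t (ω j l))))) ω)
    (fun _ _ => bot_le) (Finset.mem_univ i)

/-- The starting-point integral of one summand of the exit bound: for `X` ranging over the box,
`∫_{Λ} 𝟙{m_{ik}(X) ≤ ρ} G m_{ik}(X) dX ≤ G ρ · 2 ρ L^{3N-1}` (`ρ ≥ 0`). [folklore] -/
theorem lintegral_box_indicator_min_le {L G ρ : ℝ} (hL : 0 ≤ L) (hG : 0 ≤ G) (hρ : 0 ≤ ρ)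
    (i : Fin N) (k : Fin 3) :
    ∫⁻ X in boxN N L, {X : Config N | min (X i k) (L - X i k) ≤ ρ}.indicator
        (fun X => ENNReal.ofReal (G * min (X i k) (L - X i k))) X ≤
      ENNReal.ofReal (G * ρ * (2 * ρ * L ^ (3 * N - 1))) := by
  have hmeas : MeasurableSet {X : Config N | min (X i k) (L - X i k) ≤ ρ} := by
    refine measurableSet_le ?_ measurable_const
    have hc : Measurable fun X : Config N => X i k :=
      (measurable_pi_apply k).comp ((WithLp.measurable_ofLp 2 _).comp (measurable_pi_apply i))
    exact hc.min (measurable_const.sub hc)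
  calc ∫⁻ X in boxN N L, {X : Config N | min (X i k) (L - X i k) ≤ ρ}.indicator
        (fun X => ENNReal.ofReal (G * min (X i k) (L - X i k))) X
      ≤ ∫⁻ X in boxN N L, {X : Config N | min (X i k) (L - X i k) ≤ ρ}.indicator
        (fun _ => ENNReal.ofReal (G * ρ)) X := by
        refine lintegral_mono fun X => Set.indicator_le_indicator' fun hX => ?_
        exact ENNReal.ofReal_le_ofReal (mul_le_mul_of_nonneg_left hX hG)
    _ = ENNReal.ofReal (G * ρ) * volume ({X : Config N | min (X i k) (L - X i k) ≤ ρ} ∩ boxN N L) := by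
        rw [lintegral_indicator hmeas, setLIntegral_const, Measure.restrict_apply hmeas]
    _ ≤ ENNReal.ofReal (G * ρ) * ENNReal.ofReal (2 * ρ * L ^ (3 * N - 1)) := by
        refine mul_le_mul' le_rfl ?_
        refine (measure_mono fun X hX => ?_).trans (volume_slab_le hL hρ i k)
        exact ⟨hX.2, hX.1⟩
    _ = ENNReal.ofReal (G * ρ * (2 * ρ * L ^ (3 * N - 1))) := by
        rw [← ENNReal.ofReal_mul (by positivity : 0 ≤ G * ρ)]

/-- **The exit (killing) term is `O(t^{3/2})`**: for `ψ` vanishing off `Λ_L^N` (`L ≥ 0`) with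
`|ψ(Y) - ψ(Z)| ≤ G‖Y - Z‖`, and `t > 0`,
`∫ dX E[𝟙{exit ≤ t} |ψ(X)| |ψ(X + √2 b_t)|] ≤ 792 √2 N² G² L^{3N-1} t^{3/2}`. [folklore] -/
theorem lintegral_exit_le {ψ : Config N → ℝ} {L G : ℝ} (hL : 0 ≤ L)
    (h0 : ∀ Y, Y ∉ boxN N L → ψ Y = 0) (hLip : ∀ Y Z, |ψ Y - ψ Z| ≤ G * ‖Y - Z‖) (hG : 0 ≤ G)
    {t : ℝ≥0} (ht : t ≠ 0) :
    ∫⁻ X, ∫⁻ ω, (survives L t X)ᶜ.indicator (1 : PathSpace N → ℝ≥0∞) ω *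
        (‖ψ X‖ₑ * ‖ψ (X + displacement t ω)‖ₑ) ∂wienerPaths N ∂volume ≤
      ENNReal.ofReal (792 * Real.sqrt 2 * (N : ℝ) ^ 2 * G ^ 2 * L ^ (3 * N - 1) *
        ((t : ℝ) * Real.sqrt t)) := by
  -- abbreviations
  set R : PathSpace N → ℝ := fun ω => Real.sqrt 2 * ∑ j, ∑ l, runSup t (ω j l) with hR
  set A : Fin N → Fin 3 → Config N → PathSpace N → ℝ≥0∞ := fun i k X ω =>
    {ω : PathSpace N | min (X i k) (L - X i k) ≤ Real.sqrt 2 * runSup t (ω i k)}.indicator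
      (fun ω => ENNReal.ofReal (G * min (X i k) (L - X i k)) * ENNReal.ofReal (G * (2 * R ω))) ω
    with hA
  have hRm : Measurable R :=
    measurable_const.mul (Finset.measurable_sum _ fun j _ => Finset.measurable_sum _ fun l _ =>
      (measurable_runSup t).comp ((measurable_pi_apply l).comp (measurable_pi_apply j)))
  have hR0 : ∀ ω, 0 ≤ R ω := fun ω => mul_nonneg (Real.sqrt_nonneg _)
    (Finset.sum_nonneg fun j _ => Finset.sum_nonneg fun l _ => runSup_nonneg _ _)
  have hcoord : ∀ (i : Fin N) (k : Fin 3), Measurable fun X : Config N => X i k := fun i k =>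
    (measurable_pi_apply k).comp ((WithLp.measurable_ofLp 2 _).comp (measurable_pi_apply i))
  have hrunm : ∀ (i : Fin N) (k : Fin 3), Measurable fun ω : PathSpace N => runSup t (ω i k) :=
    fun i k => (measurable_runSup t).comp ((measurable_pi_apply k).comp (measurable_pi_apply i))
  -- joint measurability of each summand
  have hAm : ∀ i k, Measurable fun p : Config N × PathSpace N => A i k p.1 p.2 := by
    intro i k
    simp only [hA]
    have hset : MeasurableSet {p : Config N × PathSpace N |
        min (p.1 i k) (L - p.1 i k) ≤ Real.sqrt 2 * runSup t (p.2 i k)} :=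
      measurableSet_le (((hcoord i k).comp measurable_fst).min
        (measurable_const.sub ((hcoord i k).comp measurable_fst)))
        (measurable_const.mul ((hrunm i k).comp measurable_snd))
    have hf : Measurable fun p : Config N × PathSpace N =>
        ENNReal.ofReal (G * min (p.1 i k) (L - p.1 i k)) * ENNReal.ofReal (G * (2 * R p.2)) :=
      (ENNReal.measurable_ofReal.comp (measurable_const.mul (((hcoord i k).comp measurable_fst).min
        (measurable_const.sub ((hcoord i k).comp measurable_fst))))).mul
        (ENNReal.measurable_ofReal.comp (measurable_const.mul (measurable_const.mul
          (hRm.comp measurable_snd))))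
    exact hf.indicator hset
  -- Step 1: pointwise bound and linearity
  have hstep1 : ∫⁻ X, ∫⁻ ω, (survives L t X)ᶜ.indicator (1 : PathSpace N → ℝ≥0∞) ω *
      (‖ψ X‖ₑ * ‖ψ (X + displacement t ω)‖ₑ) ∂wienerPaths N ∂volume ≤
      ∑ i, ∑ k, ∫⁻ X in boxN N L, ∫⁻ ω, A i k X ω ∂wienerPaths N ∂volume := by
    have hzero : ∀ X, X ∉ boxN N L → ∫⁻ ω, (survives L t X)ᶜ.indicator (1 : PathSpace N → ℝ≥0∞) ω *
        (‖ψ X‖ₑ * ‖ψ (X + displacement t ω)‖ₑ) ∂wienerPaths N = 0 := by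
      intro X hX
      simp [h0 X hX]
    calc ∫⁻ X, ∫⁻ ω, (survives L t X)ᶜ.indicator (1 : PathSpace N → ℝ≥0∞) ω *
          (‖ψ X‖ₑ * ‖ψ (X + displacement t ω)‖ₑ) ∂wienerPaths N ∂volume
        = ∫⁻ X in boxN N L, ∫⁻ ω, (survives L t X)ᶜ.indicator (1 : PathSpace N → ℝ≥0∞) ω *
          (‖ψ X‖ₑ * ‖ψ (X + displacement t ω)‖ₑ) ∂wienerPaths N ∂volume := by
          rw [← lintegral_indicator (measurableSet_boxN N L)]
          refine lintegral_congr fun X => ?_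
          by_cases hX : X ∈ boxN N L
          · rw [Set.indicator_of_mem hX]
          · rw [Set.indicator_of_notMem hX, hzero X hX]
      _ ≤ ∫⁻ X in boxN N L, ∫⁻ ω, ∑ i, ∑ k, A i k X ω ∂wienerPaths N ∂volume :=
          lintegral_mono fun X => lintegral_mono fun ω => exit_integrand_le h0 hLip hG t X ω
      _ = ∑ i, ∑ k, ∫⁻ X in boxN N L, ∫⁻ ω, A i k X ω ∂wienerPaths N ∂volume := by
          have hAm1 : ∀ i k, Measurable fun X : Config N => ∫⁻ ω, A i k X ω ∂wienerPaths N :=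
            fun i k => (hAm i k).lintegral_prod_right'
          have hAm2 : ∀ i k (X : Config N), Measurable fun ω : PathSpace N => A i k X ω :=
            fun i k X => (hAm i k).comp measurable_prodMk_left
          have h1 : ∀ X, ∫⁻ ω, ∑ i, ∑ k, A i k X ω ∂wienerPaths N =
              ∑ i, ∑ k, ∫⁻ ω, A i k X ω ∂wienerPaths N := fun X => by
            rw [lintegral_finsetSum _ fun i _ => Finset.measurable_sum _ fun k _ => hAm2 i k X]
            exact Finset.sum_congr rfl fun i _ => lintegral_finsetSum _ fun k _ => hAm2 i k X
          simp_rw [h1]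
          rw [lintegral_finsetSum _ fun i _ => Finset.measurable_sum _ fun k _ => hAm1 i k]
          exact Finset.sum_congr rfl fun i _ => lintegral_finsetSum _ fun k _ => hAm1 i k
  -- Step 2: each summand, swap and integrate the starting point over the slab
  have hstep2 : ∀ i k, ∫⁻ X in boxN N L, ∫⁻ ω, A i k X ω ∂wienerPaths N ∂volume ≤
      ENNReal.ofReal (8 * Real.sqrt 2 * G ^ 2 * L ^ (3 * N - 1)) *
        ∫⁻ ω, ENNReal.ofReal ((∑ j, ∑ l, runSup t (ω j l)) * runSup t (ω i k) ^ 2) ∂wienerPaths N := by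
    intro i k
    rw [lintegral_lintegral_swap ((hAm i k).comp (measurable_fst.prodMk measurable_snd)).aemeasurable]
    · calc ∫⁻ ω, ∫⁻ X in boxN N L, A i k X ω ∂volume ∂wienerPaths N
          ≤ ∫⁻ ω, ENNReal.ofReal (G * (2 * R ω)) * ENNReal.ofReal (G * (Real.sqrt 2 * runSup t (ω i k)) *
              (2 * (Real.sqrt 2 * runSup t (ω i k)) * L ^ (3 * N - 1))) ∂wienerPaths N := by
            refine lintegral_mono fun ω => ?_
            have hρ : 0 ≤ Real.sqrt 2 * runSup t (ω i k) := mul_nonneg (Real.sqrt_nonneg _) (runSup_nonneg _ _)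
            have hsplit : ∀ X, A i k X ω = {X : Config N | min (X i k) (L - X i k) ≤
                Real.sqrt 2 * runSup t (ω i k)}.indicator
                (fun X => ENNReal.ofReal (G * min (X i k) (L - X i k))) X * ENNReal.ofReal (G * (2 * R ω)) := by
              intro X
              simp only [hA, Set.indicator, Set.mem_setOf_eq]
              split_ifs <;> simp
            simp_rw [hsplit]
            rw [lintegral_mul_const' _ _ ENNReal.ofReal_ne_top, mul_comm]
            exact mul_le_mul' le_rfl (lintegral_box_indicator_min_le hL hG hρ i k)
        _ = ∫⁻ ω, ENNReal.ofReal (8 * Real.sqrt 2 * G ^ 2 * L ^ (3 * N - 1)) *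
              ENNReal.ofReal ((∑ j, ∑ l, runSup t (ω j l)) * runSup t (ω i k) ^ 2) ∂wienerPaths N := by
            refine lintegral_congr fun ω => ?_
            rw [← ENNReal.ofReal_mul (mul_nonneg hG (mul_nonneg zero_le_two (hR0 ω))),
              ← ENNReal.ofReal_mul (by positivity : 0 ≤ 8 * Real.sqrt 2 * G ^ 2 * L ^ (3 * N - 1))]
            congr 1
            simp only [hR]
            have h2 : Real.sqrt 2 * Real.sqrt 2 = 2 := Real.mul_self_sqrt zero_le_two
            have h3 : Real.sqrt 2 * Real.sqrt 2 * Real.sqrt 2 = 2 * Real.sqrt 2 := by rw [h2]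
            linear_combination (4 * G ^ 2 * L ^ (3 * N - 1) *
              (∑ j, ∑ l, runSup t (ω j l)) * runSup t (ω i k) ^ 2) * h3
        _ = _ := lintegral_const_mul _ (ENNReal.measurable_ofReal.comp
              ((Finset.measurable_sum _ fun j _ => Finset.measurable_sum _ fun l _ => hrunm j l).mul
                ((hrunm i k).pow_const 2)))
  -- Step 3: the cubic moments
  calc ∫⁻ X, ∫⁻ ω, (survives L t X)ᶜ.indicator (1 : PathSpace N → ℝ≥0∞) ω *
        (‖ψ X‖ₑ * ‖ψ (X + displacement t ω)‖ₑ) ∂wienerPaths N ∂volume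
      ≤ ∑ i, ∑ k, ∫⁻ X in boxN N L, ∫⁻ ω, A i k X ω ∂wienerPaths N ∂volume := hstep1
    _ ≤ ∑ _i : Fin N, ∑ _k : Fin 3, ENNReal.ofReal (8 * Real.sqrt 2 * G ^ 2 * L ^ (3 * N - 1)) *
        ENNReal.ofReal ((3 * N : ℕ) * (11 * ((t : ℝ) * Real.sqrt t))) := by
        refine Finset.sum_le_sum fun i _ => Finset.sum_le_sum fun k _ => (hstep2 i k).trans ?_
        exact mul_le_mul' le_rfl (lintegral_sum_runSup_mul_sq_le ht i k)
    _ = ENNReal.ofReal (3 * N) * (ENNReal.ofReal (8 * Real.sqrt 2 * G ^ 2 * L ^ (3 * N - 1)) *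
        ENNReal.ofReal ((3 * N : ℕ) * (11 * ((t : ℝ) * Real.sqrt t)))) := sum_sum_const _
    _ = ENNReal.ofReal (792 * Real.sqrt 2 * (N : ℝ) ^ 2 * G ^ 2 * L ^ (3 * N - 1) *
        ((t : ℝ) * Real.sqrt t)) := by
        rw [← ENNReal.ofReal_mul (by positivity : 0 ≤ 8 * Real.sqrt 2 * G ^ 2 * L ^ (3 * N - 1)),
          ← ENNReal.ofReal_mul (by positivity : (0 : ℝ) ≤ 3 * N)]
        congr 1
        push_cast
        ring

end Literature.MathematicalPhysics.QuantumManyBody.BoseGas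

end
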